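import Summits.BirchSwinnertonDyer.Rank1Residual.Supersingular.X6KuriharaOfferShape
import HarnessLib

/-!
# N5 (X7 ∧ `r_an = 0`, `p ≥ 5`, surj(p), `p ∤ ∏c`) PER-PAIR OFFER SHAPES: `BSD(E,p)` from the literal integer
# equation, a LANDED twist record + rounding certificate, kernel certificates, and EXACTLY the binders
# {Kim Thm 1.9 (6), period, GZK, modularity, the newform, surj(p), `r_an = 0`, `p ∤ ∏c`, [cyclicity], the `L`-value enclosure}

Cell `b2b-bsdres`, supersingular family, prover A = unit `b2b-bsdres-x10b` (gen 12), X7 joint pair A side.  Topic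
file; namespace `Summit.BirchSwinnertonDyer.Rank1Residual.Supersingular`.  THEOREMS ONLY (compositions by
name); no named fact, no definition, nothing asserted about any curve, nothing booked; X7 stays
CONSTRUCTION-SHAPED (mark of RESIDUAL-MAP §I N5 unchanged).

HONEST FRAMING (run/shared/lean/b2b/bsd-rank1-residual/, verbatim in every file): the goal of the
cell is to DELETE the COMBINATION-SHAPED residual classes of the Birch–Swinnerton-Dyer formula for
ALL analytic-rank `≤ 1` elliptic curves over `ℚ` — "full BSD formula for every rank `≤ 1` curve in
class `C`" assembled STRICTLY from published theorems — so that the rank-`≤ 1` remainder becomes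
exactly the CONSTRUCTION-SHAPED classes, which are TYPED (missing-input `Prop`s), NOT attempted.
This is not "finishing BSD".

The X7 companions of `X6KuriharaOfferShape{,Cyc,Min,MinCyc}.lean` (N4): same composition —
`integralModelInt` of the literal model from `IsGloballyMinimal` (supplied as `hmin`: x11c's bounded or
additive-p3's factored Kraus criterion per pair), class X7 by additive-p3's `classX7_of_intModel` (good
supersingular at `p`, an additive prime `q`), the Kolyvagin level and its cyclicity from point counts (n1011-p03),
the dlog characters, and gen 12's consumer `X7.bsdp_rankZero_of_certifiedL_of_LValueBall` (hball restated
through twisted `L`-values).  `surj(p)` stays a DATA binder here (Cremona `galrep`; x11c's Serre-witness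
certificate `IntModel.hasSurjectiveModNGaloisRep_of_intModel_of_serreWitnesses` could discharge it per pair,
as additive-p3 GEN 20 did on the rank-one rows).  Per pair; NOT a class theorem; nothing booked.
-/

set_option autoImplicit false

noncomputable section

open scoped Classical MatrixGroups ModularForm

open CongruenceSubgroup WeierstrassCurve Literature.NumberTheory.EllipticCurves
  Literature.NumberTheory.EllipticCurves.ModularForms
  Literature.NumberTheory.EllipticCurves.Rank1Residual
  Literature.NumberTheory.EllipticCurves.Rank1Residual.Typed
  Literature.NumberTheory.EllipticCurves.Rank1Residual.X11RankOneCertificates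
  Summit.BirchSwinnertonDyer.BirchSwinnertonDyer.Rank1Residual.IntModel
  Summit.BirchSwinnertonDyer.BirchSwinnertonDyer.Rank1Residual.X11RankOne
  Summit.BirchSwinnertonDyer.Rank1Residual.X11b
  Summit.BirchSwinnertonDyer.Rank1Residual.Supersingular.KuriharaTwist

namespace Summit.BirchSwinnertonDyer.Rank1Residual.Supersingular

/-- **N5 RECORD SHAPE — `BSD(E,p)` on X7 ∧ `r_an = 0` ∧ `p ≥ 5` ∧ surj(p) ∧ `p ∤ ∏c` from the literal equation, a
landed twist record + rounding certificate, kernel certificates, and the `L`-value enclosure** (the X7 companion of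
`X6RankZero.bsdp_of_ainvs_of_certifiedL_of_LValueBall_min`: `IsGloballyMinimal` supplied as `hmin` — bounded or
factored Kraus per pair —, class X7 = good supersingular at `p` + an ADDITIVE prime `q` (`q ∣ Δ`, `q ∣ c₄`,
additive-p3's `classX7_of_intModel`), and the surjectivity of `ρ̄_{E,p}` as the DATA binder `hsurj` (Cremona
`galrep`; a kernel certificate by Serre witnesses exists in the tree but is not wired here).**  Decidable inputs: `p ∤ Δ`,
`countPoints … p = n_p`, `p ∣ p+1−n_p`, `q ∣ Δ`, `q ∣ c₄` (class X7); the level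
`r.n = ℓ₁ℓ₂` of the landed `CertifiedL` row `r` with `ℓᵢ ∤ Δ`, `ℓᵢ ≡ 1 (p)`, `countPoints … ℓᵢ = nᵢ`,
`p ∣ nᵢ`, `p² ∤ nᵢ` (Kolyvagin + cyclic, n1011-p03's certificates) and `A = (ℓ₁+1−n₁−2)(ℓ₂+1−n₂−2)`
(`= Π(a_ℓ − 2)`); a rounding certificate `c` passing `validHasse` and matching `r`; surjective discrete
logarithms `ψ₁, ψ₂` (per pair `dlogChar ℓᵢ p ηᵢ`).  REMAINING HYPOTHESES = EXACTLY the named facts `hKim`,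
`hϖ`, `hGZK`, `hmod`; the newform `f` (`hf`); the data binders `surj(p)`, `r_an = 0`, `p ∤ ∏c`; and `hballL`, the
engine's enclosure of `D'·c_∞·re(A·L(E,1) + Σ_{j≠0} e_p(−jk)·τ(χ_j)·L_j(1))/(p·Ω⁺_f)`.  Per pair; NOT a
class theorem; nothing booked. [cite: Kim2022StructureSelmer, Thm. 1.9 (6) (PDF p. 8), Cor. 1.6]
[cite: MazurTateTeitelbaum1986Invent, §I.8 (8.6)] [cite: CremonaAlgorithms1997, §2.8 (2.8.8) (PDF p. 26)]
[cite: SilvermanAEC2009, VII.5 Prop. 5.1(a) and (b)] [cite: IrelandRosen1990, Prop. 5.1.2 and §8.1] -/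
theorem X7RankZero.bsdp_of_ainvs_of_certifiedL_of_LValueBall
    (hKim : Kim2022_rankZero_padicValRat_sha_of_kuriharaNumber_ne_zero)
    (hϖ : realPeriodRat_eq_unit_mul_plusPeriod)
    (hGZK : rank_eq_analyticRank_of_analyticRank_le_one) (hmod : hasEntireLFunction_rat)
    (a1 a2 a3 a4 a6 : ℤ)
    (hmin : (⟨a1, a2, a3, a4, a6⟩ : WeierstrassCurve ℚ).IsGloballyMinimal)
    -- the landed twist record and its rounding certificate
    {rs : List TwistRecord} (hrs : CertifiedL rs) {r : TwistRecord} (hr : r ∈ rs) [Fact r.p.Prime] [NeZero r.n]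
    (hνp : r.primes.length < r.p) (hν : r.n.primeFactors.card = r.primes.length)
    {c : RoundingCert} (hcv : c.validHasse = true)
    (hcp : c.p = r.p) (hcn : c.n = r.n) (hcden : c.den = r.den) (hcbins : c.bins = r.bins) (hD' : 0 < c.dstar)
    (hp : 5 ≤ r.p)
    -- class X7 at `p` from the model: good supersingular at `p` + an additive prime `q`; `surj(p)` is DATA
    (hpΔ : ¬ (r.p : ℤ) ∣ discOf [a1, a2, a3, a4, a6]) {np : ℕ}
    (hcnt : countPoints [a1, a2, a3, a4, a6] r.p = np) (hap : (r.p : ℤ) ∣ (r.p : ℤ) + 1 - np)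
    (q : ℕ) (hq : q.Prime) (hqΔ : (q : ℤ) ∣ discOf [a1, a2, a3, a4, a6]) (hqc₄ : (q : ℤ) ∣ c4Of [a1, a2, a3, a4, a6])
    (hsurj : Surj (⟨a1, a2, a3, a4, a6⟩ : WeierstrassCurve ℚ) r.p)
    -- the Kolyvagin level `r.n = ℓ₁ · ℓ₂` from point counts
    (ℓ₁ ℓ₂ : ℕ) [Fact ℓ₁.Prime] [Fact ℓ₂.Prime] (hrn : r.n = ℓ₁ * ℓ₂) (hne : ℓ₁ ≠ ℓ₂)
    (hℓ₁p : ℓ₁ ≠ r.p) (hℓ₂p : ℓ₂ ≠ r.p) (hℓ₁2 : ℓ₁ ≠ 2) (hℓ₂2 : ℓ₂ ≠ 2)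
    (hℓ₁Δ : ¬ (ℓ₁ : ℤ) ∣ discOf [a1, a2, a3, a4, a6]) (hℓ₂Δ : ¬ (ℓ₂ : ℤ) ∣ discOf [a1, a2, a3, a4, a6])
    (h1₁ : ℓ₁ ≡ 1 [MOD r.p ^ 1]) (h1₂ : ℓ₂ ≡ 1 [MOD r.p ^ 1]) {n₁ n₂ : ℕ}
    (hc₁ : countPoints [a1, a2, a3, a4, a6] ℓ₁ = n₁) (hc₂ : countPoints [a1, a2, a3, a4, a6] ℓ₂ = n₂)
    (hd₁ : r.p ^ 1 ∣ n₁) (hd₂ : r.p ^ 1 ∣ n₂) (hsq₁ : ¬ r.p ^ 2 ∣ n₁) (hsq₂ : ¬ r.p ^ 2 ∣ n₂)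
    {A : ℤ} (hA : A = ((ℓ₁ : ℤ) + 1 - n₁ - 2) * ((ℓ₂ : ℤ) + 1 - n₂ - 2))
    -- the discrete logarithms
    (ψ₁ : (ZMod ℓ₁)ˣ →* Multiplicative (ZMod (r.p ^ 1))) (hψ₁ : Function.Surjective ψ₁)
    (ψ₂ : (ZMod ℓ₂)ˣ →* Multiplicative (ZMod (r.p ^ 1))) (hψ₂ : Function.Surjective ψ₂)
    -- data binders
    (hr0 : (⟨a1, a2, a3, a4, a6⟩ : WeierstrassCurve ℚ).analyticRank = 0)
    (htam : ¬ r.p ∣ (⟨a1, a2, a3, a4, a6⟩ : WeierstrassCurve ℚ).tamagawaProduct)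
    {N : ℕ} [NeZero N] (f : CuspForm (Gamma0 N) 2) (hf : IsNewformOf (⟨a1, a2, a3, a4, a6⟩ : WeierstrassCurve ℚ) f)
    -- the engine's enclosure claim, through twisted L-values
    (hballL : ∀ (L : ZMod (r.p ^ 1) → ℂ → ℂ), (∀ j, j ≠ 0 → Differentiable ℂ (L j)) →
      (∀ j, j ≠ 0 → ∀ s : ℂ, 2 < s.re →
        L j s = twistedLSeries f (binChar r.n (pairLogs ℓ₁ ℓ₂ ψ₁ ψ₂) j)⁻¹ s) →
      ∀ k < r.p, ∃ mid rad : ℝ, rad ≤ (c.radNum : ℝ) / 10 ^ c.radExp ∧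
        |mid - ((c.binsStar.getD k 0 : ℤ) : ℝ)| ≤ (c.marNum : ℝ) / 10 ^ c.marExp ∧
        |(c.dstar : ℝ) * ((r.components : ℝ) *
          (((A : ℂ) * (⟨a1, a2, a3, a4, a6⟩ : WeierstrassCurve ℚ).entireLFunction 1 +
            ∑ j ∈ (Finset.univ : Finset (ZMod (r.p ^ 1))).erase 0,
              ZMod.stdAddChar (-(j * (k : ZMod (r.p ^ 1)))) *
                (gaussSum (binChar r.n (pairLogs ℓ₁ ℓ₂ ψ₁ ψ₂) j) (ZMod.stdAddChar (N := r.n)) * L j 1)).re /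
            ((r.p ^ 1 : ℕ) * plusPeriod f))) - mid| ≤ rad) :
    BSDp (⟨a1, a2, a3, a4, a6⟩ : WeierstrassCurve ℚ) r.p := by
  have h0 : discOf [a1, a2, a3, a4, a6] ≠ 0 := fun h ↦ hpΔ (by rw [h]; exact dvd_zero _)
  haveI := isElliptic_of_discOf_ne_zero a1 a2 a3 a4 a6 h0
  haveI := hmin
  have hI : integralModelInt (⟨a1, a2, a3, a4, a6⟩ : WeierstrassCurve ℚ) = ⟨a1, a2, a3, a4, a6⟩ :=
    integralModelInt_eq_of_map_eq _ (map_mk_int a1 a2 a3 a4 a6)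
  have hp2 : r.p ≠ 2 := by omega
  have hN₁ := natCard_point_eq_of_countPoints a1 a2 a3 a4 a6 ℓ₁ hℓ₁2 hℓ₁Δ hc₁
  have hN₂ := natCard_point_eq_of_countPoints a1 a2 a3 a4 a6 ℓ₂ hℓ₂2 hℓ₂Δ hc₂
  -- class X7 at `p`
  have hX : ClassX7 (⟨a1, a2, a3, a4, a6⟩ : WeierstrassCurve ℚ) r.p :=
    classX7_of_intModel r.p hI (by rw [intCurve_Δ]; exact hpΔ)
      (natCard_point_eq_of_countPoints a1 a2 a3 a4 a6 r.p hp2 hpΔ hcnt) hap q hq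
      (by rw [intCurve_Δ]; exact hqΔ) (by rw [intCurve_c₄]; exact hqc₄)
  -- the Kolyvagin level and cyclicity from the two point counts
  have hK₁ : Kato.IsKolyvaginPrime (⟨a1, a2, a3, a4, a6⟩ : WeierstrassCurve ℚ) r.p 1 ℓ₁ :=
    Additive.isKolyvaginPrime_of_intModel_of_card hI r.p 1 ℓ₁ hℓ₁p (by rw [intCurve_Δ]; exact hℓ₁Δ) h1₁ hN₁ hd₁
  have hK₂ : Kato.IsKolyvaginPrime (⟨a1, a2, a3, a4, a6⟩ : WeierstrassCurve ℚ) r.p 1 ℓ₂ :=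
    Additive.isKolyvaginPrime_of_intModel_of_card hI r.p 1 ℓ₂ hℓ₂p (by rw [intCurve_Δ]; exact hℓ₂Δ) h1₂ hN₂ hd₂
  have hn : Kato.IsKolyvaginProduct (⟨a1, a2, a3, a4, a6⟩ : WeierstrassCurve ℚ) r.p 1 r.n := by
    rw [hrn]; exact Additive.isKolyvaginProduct_mul hK₁ hK₂ hne
  have hcyc : ∀ (ℓ : ℕ) [Fact ℓ.Prime], ℓ ∣ r.n →
      Nat.card {P : ((WeierstrassCurve.integralModelInt (⟨a1, a2, a3, a4, a6⟩ : WeierstrassCurve ℚ)).map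
          (Int.castRingHom (ZMod ℓ))).toAffine.Point // r.p • P = 0} ≤ r.p := by
    rw [hrn]
    exact Additive.forall_card_torsion_le_of_pair hI r.p ℓ₁ ℓ₂ hN₁ hN₂ hsq₁ hsq₂
  -- the discrete logarithms
  have hψ : ∀ ℓ ∈ r.n.primeFactors, Function.Surjective (pairLogs ℓ₁ ℓ₂ ψ₁ ψ₂ ℓ) := by
    rw [hrn]
    exact surjective_pairLogs_of_mem_primeFactors ψ₁ ψ₂ Fact.out Fact.out hne hψ₁ hψ₂
  -- the certificate row as a one-element `RoundingCertifiedHasse` list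
  have hcs : RoundingCertifiedHasse [c] :=
    (RoundingCertifiedHasse.cons_iff c []).2 ⟨hcv, RoundingCertifiedHasse.nil⟩
  -- `A = Π_{ℓ ∣ n} (a_ℓ − 2)`
  have hprod : (∏ ℓ ∈ r.n.primeFactors,
      (((⟨a1, a2, a3, a4, a6⟩ : WeierstrassCurve ℚ).frobeniusTrace ℓ : ℂ) - 2)) = (A : ℂ) := by
    rw [hrn]; exact prod_primeFactors_frobeniusTrace_sub_two_eq hI Fact.out Fact.out hne hN₁ hN₂ hA
  refine X7.bsdp_rankZero_of_certifiedL_of_LValueBall _ hKim hϖ hGZK hmod hrs hr hνp hν hcs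
    (List.mem_singleton_self c) hcp hcn hcden hcbins hD' hp hX hsurj hr0 htam f hf
    (coprime_level_of_isKolyvaginProduct hf hn) hn hcyc (pairLogs ℓ₁ ℓ₂ ψ₁ ψ₂) hψ ?_
  intro L hL hL' k hk
  obtain ⟨mid, rad, h1, h2, h3⟩ := hballL L hL hL' k hk
  refine ⟨mid, rad, h1, h2, ?_⟩
  rw [hprod]
  exact h3

/-- **N5 RECORD SHAPE with the cyclicity binder** — as `X7RankZero.bsdp_of_ainvs_of_certifiedL_of_LValueBall` but with the
cyclicity of `Ẽ(𝔽_ℓ)[p^∞]` (`ℓ ∣ n`) taken as the displayed hypothesis `hcyc` (levels with `p² ∣ #Ẽ(𝔽_ℓ)`).**  Decidable inputs: `p ∤ Δ`,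
`countPoints … p = n_p`, `p ∣ p+1−n_p`, `q ∣ Δ`, `q ∣ c₄` (class X7); the level
`r.n = ℓ₁ℓ₂` of the landed `CertifiedL` row `r` with `ℓᵢ ∤ Δ`, `ℓᵢ ≡ 1 (p)`, `countPoints … ℓᵢ = nᵢ`,
`p ∣ nᵢ`, `p² ∤ nᵢ` (Kolyvagin + cyclic, n1011-p03's certificates) and `A = (ℓ₁+1−n₁−2)(ℓ₂+1−n₂−2)`
(`= Π(a_ℓ − 2)`); a rounding certificate `c` passing `validHasse` and matching `r`; surjective discrete
logarithms `ψ₁, ψ₂` (per pair `dlogChar ℓᵢ p ηᵢ`).  REMAINING HYPOTHESES = EXACTLY the named facts `hKim`,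
`hϖ`, `hGZK`, `hmod`; the newform `f` (`hf`); the data binders `surj(p)`, `r_an = 0`, `p ∤ ∏c`, `hcyc`; and `hballL`, the
engine's enclosure of `D'·c_∞·re(A·L(E,1) + Σ_{j≠0} e_p(−jk)·τ(χ_j)·L_j(1))/(p·Ω⁺_f)`.  Per pair; NOT a
class theorem; nothing booked. [cite: Kim2022StructureSelmer, Thm. 1.9 (6) (PDF p. 8), Cor. 1.6]
[cite: MazurTateTeitelbaum1986Invent, §I.8 (8.6)] [cite: CremonaAlgorithms1997, §2.8 (2.8.8) (PDF p. 26)]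
[cite: SilvermanAEC2009, VII.5 Prop. 5.1(a) and (b)] [cite: IrelandRosen1990, Prop. 5.1.2 and §8.1] -/
theorem X7RankZero.bsdp_of_ainvs_of_certifiedL_of_LValueBall_cyc
    (hKim : Kim2022_rankZero_padicValRat_sha_of_kuriharaNumber_ne_zero)
    (hϖ : realPeriodRat_eq_unit_mul_plusPeriod)
    (hGZK : rank_eq_analyticRank_of_analyticRank_le_one) (hmod : hasEntireLFunction_rat)
    (a1 a2 a3 a4 a6 : ℤ)
    (hmin : (⟨a1, a2, a3, a4, a6⟩ : WeierstrassCurve ℚ).IsGloballyMinimal)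
    -- the landed twist record and its rounding certificate
    {rs : List TwistRecord} (hrs : CertifiedL rs) {r : TwistRecord} (hr : r ∈ rs) [Fact r.p.Prime] [NeZero r.n]
    (hνp : r.primes.length < r.p) (hν : r.n.primeFactors.card = r.primes.length)
    {c : RoundingCert} (hcv : c.validHasse = true)
    (hcp : c.p = r.p) (hcn : c.n = r.n) (hcden : c.den = r.den) (hcbins : c.bins = r.bins) (hD' : 0 < c.dstar)
    (hp : 5 ≤ r.p)
    -- class X7 at `p` from the model: good supersingular at `p` + an additive prime `q`; `surj(p)` is DATA
    (hpΔ : ¬ (r.p : ℤ) ∣ discOf [a1, a2, a3, a4, a6]) {np : ℕ}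
    (hcnt : countPoints [a1, a2, a3, a4, a6] r.p = np) (hap : (r.p : ℤ) ∣ (r.p : ℤ) + 1 - np)
    (q : ℕ) (hq : q.Prime) (hqΔ : (q : ℤ) ∣ discOf [a1, a2, a3, a4, a6]) (hqc₄ : (q : ℤ) ∣ c4Of [a1, a2, a3, a4, a6])
    (hsurj : Surj (⟨a1, a2, a3, a4, a6⟩ : WeierstrassCurve ℚ) r.p)
    -- the Kolyvagin level `r.n = ℓ₁ · ℓ₂` from point counts
    (ℓ₁ ℓ₂ : ℕ) [Fact ℓ₁.Prime] [Fact ℓ₂.Prime] (hrn : r.n = ℓ₁ * ℓ₂) (hne : ℓ₁ ≠ ℓ₂)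
    (hℓ₁p : ℓ₁ ≠ r.p) (hℓ₂p : ℓ₂ ≠ r.p) (hℓ₁2 : ℓ₁ ≠ 2) (hℓ₂2 : ℓ₂ ≠ 2)
    (hℓ₁Δ : ¬ (ℓ₁ : ℤ) ∣ discOf [a1, a2, a3, a4, a6]) (hℓ₂Δ : ¬ (ℓ₂ : ℤ) ∣ discOf [a1, a2, a3, a4, a6])
    (h1₁ : ℓ₁ ≡ 1 [MOD r.p ^ 1]) (h1₂ : ℓ₂ ≡ 1 [MOD r.p ^ 1]) {n₁ n₂ : ℕ}
    (hc₁ : countPoints [a1, a2, a3, a4, a6] ℓ₁ = n₁) (hc₂ : countPoints [a1, a2, a3, a4, a6] ℓ₂ = n₂)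
    (hd₁ : r.p ^ 1 ∣ n₁) (hd₂ : r.p ^ 1 ∣ n₂)
    (hcyc : ∀ (ℓ : ℕ) [Fact ℓ.Prime], ℓ ∣ r.n →
      Nat.card {P : (((⟨a1, a2, a3, a4, a6⟩ : WeierstrassCurve ℤ)).map
          (Int.castRingHom (ZMod ℓ))).toAffine.Point // r.p • P = 0} ≤ r.p)
    {A : ℤ} (hA : A = ((ℓ₁ : ℤ) + 1 - n₁ - 2) * ((ℓ₂ : ℤ) + 1 - n₂ - 2))
    -- the discrete logarithms
    (ψ₁ : (ZMod ℓ₁)ˣ →* Multiplicative (ZMod (r.p ^ 1))) (hψ₁ : Function.Surjective ψ₁)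
    (ψ₂ : (ZMod ℓ₂)ˣ →* Multiplicative (ZMod (r.p ^ 1))) (hψ₂ : Function.Surjective ψ₂)
    -- data binders
    (hr0 : (⟨a1, a2, a3, a4, a6⟩ : WeierstrassCurve ℚ).analyticRank = 0)
    (htam : ¬ r.p ∣ (⟨a1, a2, a3, a4, a6⟩ : WeierstrassCurve ℚ).tamagawaProduct)
    {N : ℕ} [NeZero N] (f : CuspForm (Gamma0 N) 2) (hf : IsNewformOf (⟨a1, a2, a3, a4, a6⟩ : WeierstrassCurve ℚ) f)
    -- the engine's enclosure claim, through twisted L-values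
    (hballL : ∀ (L : ZMod (r.p ^ 1) → ℂ → ℂ), (∀ j, j ≠ 0 → Differentiable ℂ (L j)) →
      (∀ j, j ≠ 0 → ∀ s : ℂ, 2 < s.re →
        L j s = twistedLSeries f (binChar r.n (pairLogs ℓ₁ ℓ₂ ψ₁ ψ₂) j)⁻¹ s) →
      ∀ k < r.p, ∃ mid rad : ℝ, rad ≤ (c.radNum : ℝ) / 10 ^ c.radExp ∧
        |mid - ((c.binsStar.getD k 0 : ℤ) : ℝ)| ≤ (c.marNum : ℝ) / 10 ^ c.marExp ∧
        |(c.dstar : ℝ) * ((r.components : ℝ) *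
          (((A : ℂ) * (⟨a1, a2, a3, a4, a6⟩ : WeierstrassCurve ℚ).entireLFunction 1 +
            ∑ j ∈ (Finset.univ : Finset (ZMod (r.p ^ 1))).erase 0,
              ZMod.stdAddChar (-(j * (k : ZMod (r.p ^ 1)))) *
                (gaussSum (binChar r.n (pairLogs ℓ₁ ℓ₂ ψ₁ ψ₂) j) (ZMod.stdAddChar (N := r.n)) * L j 1)).re /
            ((r.p ^ 1 : ℕ) * plusPeriod f))) - mid| ≤ rad) :
    BSDp (⟨a1, a2, a3, a4, a6⟩ : WeierstrassCurve ℚ) r.p := by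
  have h0 : discOf [a1, a2, a3, a4, a6] ≠ 0 := fun h ↦ hpΔ (by rw [h]; exact dvd_zero _)
  haveI := isElliptic_of_discOf_ne_zero a1 a2 a3 a4 a6 h0
  haveI := hmin
  have hI : integralModelInt (⟨a1, a2, a3, a4, a6⟩ : WeierstrassCurve ℚ) = ⟨a1, a2, a3, a4, a6⟩ :=
    integralModelInt_eq_of_map_eq _ (map_mk_int a1 a2 a3 a4 a6)
  have hp2 : r.p ≠ 2 := by omega
  have hN₁ := natCard_point_eq_of_countPoints a1 a2 a3 a4 a6 ℓ₁ hℓ₁2 hℓ₁Δ hc₁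
  have hN₂ := natCard_point_eq_of_countPoints a1 a2 a3 a4 a6 ℓ₂ hℓ₂2 hℓ₂Δ hc₂
  -- class X7 at `p`
  have hX : ClassX7 (⟨a1, a2, a3, a4, a6⟩ : WeierstrassCurve ℚ) r.p :=
    classX7_of_intModel r.p hI (by rw [intCurve_Δ]; exact hpΔ)
      (natCard_point_eq_of_countPoints a1 a2 a3 a4 a6 r.p hp2 hpΔ hcnt) hap q hq
      (by rw [intCurve_Δ]; exact hqΔ) (by rw [intCurve_c₄]; exact hqc₄)
  -- the Kolyvagin level and cyclicity from the two point counts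
  have hK₁ : Kato.IsKolyvaginPrime (⟨a1, a2, a3, a4, a6⟩ : WeierstrassCurve ℚ) r.p 1 ℓ₁ :=
    Additive.isKolyvaginPrime_of_intModel_of_card hI r.p 1 ℓ₁ hℓ₁p (by rw [intCurve_Δ]; exact hℓ₁Δ) h1₁ hN₁ hd₁
  have hK₂ : Kato.IsKolyvaginPrime (⟨a1, a2, a3, a4, a6⟩ : WeierstrassCurve ℚ) r.p 1 ℓ₂ :=
    Additive.isKolyvaginPrime_of_intModel_of_card hI r.p 1 ℓ₂ hℓ₂p (by rw [intCurve_Δ]; exact hℓ₂Δ) h1₂ hN₂ hd₂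
  have hn : Kato.IsKolyvaginProduct (⟨a1, a2, a3, a4, a6⟩ : WeierstrassCurve ℚ) r.p 1 r.n := by
    rw [hrn]; exact Additive.isKolyvaginProduct_mul hK₁ hK₂ hne
  have hcyc' : ∀ (ℓ : ℕ) [Fact ℓ.Prime], ℓ ∣ r.n →
      Nat.card {P : ((WeierstrassCurve.integralModelInt (⟨a1, a2, a3, a4, a6⟩ : WeierstrassCurve ℚ)).map
          (Int.castRingHom (ZMod ℓ))).toAffine.Point // r.p • P = 0} ≤ r.p := by
    rw [hI]; exact hcyc
  -- the discrete logarithms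
  have hψ : ∀ ℓ ∈ r.n.primeFactors, Function.Surjective (pairLogs ℓ₁ ℓ₂ ψ₁ ψ₂ ℓ) := by
    rw [hrn]
    exact surjective_pairLogs_of_mem_primeFactors ψ₁ ψ₂ Fact.out Fact.out hne hψ₁ hψ₂
  -- the certificate row as a one-element `RoundingCertifiedHasse` list
  have hcs : RoundingCertifiedHasse [c] :=
    (RoundingCertifiedHasse.cons_iff c []).2 ⟨hcv, RoundingCertifiedHasse.nil⟩
  -- `A = Π_{ℓ ∣ n} (a_ℓ − 2)`
  have hprod : (∏ ℓ ∈ r.n.primeFactors,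
      (((⟨a1, a2, a3, a4, a6⟩ : WeierstrassCurve ℚ).frobeniusTrace ℓ : ℂ) - 2)) = (A : ℂ) := by
    rw [hrn]; exact prod_primeFactors_frobeniusTrace_sub_two_eq hI Fact.out Fact.out hne hN₁ hN₂ hA
  refine X7.bsdp_rankZero_of_certifiedL_of_LValueBall _ hKim hϖ hGZK hmod hrs hr hνp hν hcs
    (List.mem_singleton_self c) hcp hcn hcden hcbins hD' hp hX hsurj hr0 htam f hf
    (coprime_level_of_isKolyvaginProduct hf hn) hn hcyc' (pairLogs ℓ₁ ℓ₂ ψ₁ ψ₂) hψ ?_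
  intro L hL hL' k hk
  obtain ⟨mid, rad, h1, h2, h3⟩ := hballL L hL hL' k hk
  refine ⟨mid, rad, h1, h2, ?_⟩
  rw [hprod]
  exact h3

end Summit.BirchSwinnertonDyer.Rank1Residual.Supersingular

end
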